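import Mathlib.NumberTheory.MulChar.Duality
import Mathlib.NumberTheory.JacobiSum.Basic
import Mathlib.Analysis.Complex.Polynomial.Basic
import Mathlib.RingTheory.RootsOfUnity.AlgebraicallyClosed
import Mathlib.Analysis.SpecialFunctions.Pow.Real
import HarnessLib

/-!
# Route `ResidualThetaTransportAtTwo`, cruxes Kan⁺ (stmt-BirchSwinnertonDyer-20688) / node 27436 / 21437: CHARACTER SUMS for the
# coset-pair criterion — orthogonality on a coset of a subgroup of `𝔽ₚˣ`, the Jacobi-sum expansion of the cyclotomic numbers, and
# the Weil-type bound `|J(χ, ψ)| = √p`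

Cell `bsd-wall`, width seat `bsd-wall-rtt-p3-w5` g2 (2026-08-28). THEOREMS ONLY, pure finite-field character theory over `ℂ` (Mathlib
`MulChar`, `jacobiSum`); `--supports stmt-BirchSwinnertonDyer-20688`. BSD is not proved by this. Consumed by `…CuspSpanJacobi`: for a
subgroup `H ≤ 𝔽ₚˣ` of index `n` and units `a, b`, the cyclotomic number `N(a, b) := #{v : v ∈ aH, 1 − v ∈ bH}` satisfies
`n² N(a, b) = Σ_{χ, ψ ∈ H^⊥} χ(a⁻¹) ψ(b⁻¹) J(χ, ψ)`, whose main term is `J(1, 1) = p − 2` and whose other terms have norm `1`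
(`J(1, ψ) = −1`, `J(χ, χ⁻¹) = −χ(−1)`) or `√p`; hence `N(a, b) > 0` as soon as `p − 2 > 3(n − 1) + (n − 1)(n − 2)√p`.

The annihilator `H^⊥` is handled as a FINSET `X` of `ℂ`-valued multiplicative characters with the closure / separation properties as
explicit hypotheses (supplied from Mathlib's `MulChar.subgroupOrderIsoSubgroupMulChar` in `…CuspSpanJacobi`), so that no `def` is needed.

* §1 `norm_apply_coe_units` (`|χ(a)| = 1`), `star_jacobiSum`, `norm_jacobiSum_eq_sqrt` (`|J(χ,ψ)| = √p` for `χ, ψ, χψ ≠ 1`, from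
  Mathlib's `jacobiSum_mul_jacobiSum_inv`).
* §2 `sum_apply_eq_ite` (orthogonality: `Σ_{χ ∈ X} χ(m) = n·[m ∈ H]`).
* §3 `sum_sum_jacobiSum_eq_zero_of_forall_not` (if NO `v` has `v ∈ aH`, `1 − v ∈ bH`, the double character sum vanishes).
* §4 `norm_sum_sum_jacobiSum_sub_le` (the bound `|Σ − (p − 2)| ≤ 3(n−1) + (n−1)(n−2)√p`).
* §5 `exists_mem_coset_pair` (conclusion: under `3(n−1) + 2 < p` and `((n−1)(n−2))² p < (p − 2 − 3(n−1))²` every pair of cosets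
  is realised).

References: K. Ireland, M. Rosen, *A classical introduction to modern number theory*, GTM 84 (1990), Ch. 8 §§3–7 (Jacobi sums,
`N(xⁿ + yⁿ = 1)`); A. Weil, Bull. AMS 55 (1949) 497–508; [Pollack2003] Conj. 6.3 (context).
-/

set_option autoImplicit false
set_option linter.dupNamespace false

open scoped ComplexConjugate

namespace Summit.BirchSwinnertonDyer.BirchSwinnertonDyer.Theorems.SignedMuAtTwo.CharacterSums

variable {p : ℕ} [Fact p.Prime]

/-! ## §1. Norms of character values and of Jacobi sums -/

/-- `|χ(a)| = 1` for a unit `a`. [folklore] -/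
theorem norm_apply_coe_units (χ : MulChar (ZMod p) ℂ) (a : (ZMod p)ˣ) : ‖χ (a : ZMod p)‖ = 1 := by
  have h := Complex.norm_eq_one_of_mem_rootsOfUnity (χ.apply_mem_rootsOfUnity a)
  rwa [MulChar.coe_equivToUnitHom] at h

/-- `conj J(χ, ψ) = J(χ⁻¹, ψ⁻¹)`. [folklore] -/
theorem star_jacobiSum (χ ψ : MulChar (ZMod p) ℂ) : star (jacobiSum χ ψ) = jacobiSum χ⁻¹ ψ⁻¹ := by
  unfold jacobiSum
  rw [star_sum]
  refine Finset.sum_congr rfl fun x _ ↦ ?_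
  rw [star_mul', MulChar.star_apply', MulChar.star_apply']

/-- **`|J(χ, ψ)| = √p`** for `χ, ψ, χψ` non-trivial (Mathlib: `J(χ,ψ) J(χ⁻¹,ψ⁻¹) = p`). [folklore] -/
theorem norm_jacobiSum_eq_sqrt {χ ψ : MulChar (ZMod p) ℂ} (hχ : χ ≠ 1) (hψ : ψ ≠ 1) (hχψ : χ * ψ ≠ 1) :
    ‖jacobiSum χ ψ‖ = Real.sqrt p := by
  have hp : p.Prime := Fact.out
  have hchar : ringChar ℂ ≠ ringChar (ZMod p) := by
    rw [ringChar.eq_zero, ZMod.ringChar_zmod_n]; exact hp.ne_zero.symm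
  have h := jacobiSum_mul_jacobiSum_inv hchar hχ hψ hχψ
  rw [ZMod.card, ← star_jacobiSum, Complex.star_def, Complex.mul_conj, Complex.normSq_eq_norm_sq] at h
  have h' : ‖jacobiSum χ ψ‖ ^ 2 = (p : ℝ) := by exact_mod_cast h
  rw [← Real.sqrt_sq (norm_nonneg _), h']

/-! ## §2. Orthogonality on a subgroup of characters -/

/-- **Orthogonality, `m ∈ H`.** For a finite set `X` of characters trivial on `H`: `Σ_{χ ∈ X} χ(m) = #X`. [folklore] -/
theorem sum_apply_eq_card_of_mem (X : Finset (MulChar (ZMod p) ℂ)) (H : Subgroup (ZMod p)ˣ)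
    (htriv : ∀ χ ∈ X, ∀ m ∈ H, χ ((m : (ZMod p)ˣ) : ZMod p) = 1)
    {m : (ZMod p)ˣ} (hm : m ∈ H) : ∑ χ ∈ X, χ (m : ZMod p) = (X.card : ℂ) := by
  rw [Finset.sum_congr rfl fun χ hχ ↦ htriv χ hχ m hm]
  simp

/-- **Orthogonality, `m ∉ H`.** For a finite set `X` of characters closed under products and inverses and separating `𝔽ₚˣ/H`:
`Σ_{χ ∈ X} χ(m) = 0` for `m ∉ H`. [folklore] -/
theorem sum_apply_eq_zero_of_not_mem (X : Finset (MulChar (ZMod p) ℂ)) (H : Subgroup (ZMod p)ˣ)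
    (hmul : ∀ χ ∈ X, ∀ ψ ∈ X, χ * ψ ∈ X) (hinv : ∀ χ ∈ X, χ⁻¹ ∈ X)
    (hsep : ∀ m : (ZMod p)ˣ, m ∉ H → ∃ χ ∈ X, χ (m : ZMod p) ≠ 1)
    {m : (ZMod p)ˣ} (hm : m ∉ H) : ∑ χ ∈ X, χ (m : ZMod p) = 0 := by
  obtain ⟨χ₀, hχ₀, hne⟩ := hsep m hm
  have hperm : ∑ χ ∈ X, (χ₀ * χ) (m : ZMod p) = ∑ χ ∈ X, χ (m : ZMod p) := by
    refine Finset.sum_bij' (fun χ _ ↦ χ₀ * χ) (fun χ _ ↦ χ₀⁻¹ * χ) ?_ ?_ ?_ ?_ ?_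
    · exact fun χ hχ ↦ hmul _ hχ₀ _ hχ
    · exact fun χ hχ ↦ hmul _ (hinv _ hχ₀) _ hχ
    · intro χ _; rw [← mul_assoc, inv_mul_cancel, one_mul]
    · intro χ _; rw [← mul_assoc, mul_inv_cancel, one_mul]
    · intro χ _; rfl
  have e : χ₀ (m : ZMod p) * ∑ χ ∈ X, χ (m : ZMod p) = ∑ χ ∈ X, χ (m : ZMod p) := by
    calc χ₀ (m : ZMod p) * ∑ χ ∈ X, χ (m : ZMod p) = ∑ χ ∈ X, χ₀ (m : ZMod p) * χ (m : ZMod p) := Finset.mul_sum _ _ _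
      _ = ∑ χ ∈ X, (χ₀ * χ) (m : ZMod p) := Finset.sum_congr rfl fun χ _ ↦ (MulChar.mul_apply χ₀ χ _).symm
      _ = ∑ χ ∈ X, χ (m : ZMod p) := hperm
  have h0 : (χ₀ (m : ZMod p) - 1) * ∑ χ ∈ X, χ (m : ZMod p) = 0 := by rw [sub_mul, e, one_mul, sub_self]
  rcases mul_eq_zero.mp h0 with h | h
  · exact absurd (sub_eq_zero.mp h) hne
  · exact h

/-! ## §3. The double character sum of a pair of cosets vanishes if the pair is not realised -/

/-- If no `h₁, h₂ ∈ H` have `a h₁ + b h₂ = 1` (i.e. no `v ∈ aH` has `1 − v ∈ bH`), then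
`Σ_{χ, ψ ∈ X} χ(a⁻¹) ψ(b⁻¹) J(χ, ψ) = 0` (expand `J`, swap sums, orthogonality). [folklore] -/
theorem sum_sum_jacobiSum_eq_zero_of_forall_ne (X : Finset (MulChar (ZMod p) ℂ)) (H : Subgroup (ZMod p)ˣ)
    (hmul : ∀ χ ∈ X, ∀ ψ ∈ X, χ * ψ ∈ X) (hinv : ∀ χ ∈ X, χ⁻¹ ∈ X)
    (hsep : ∀ m : (ZMod p)ˣ, m ∉ H → ∃ χ ∈ X, χ (m : ZMod p) ≠ 1)
    (a b : (ZMod p)ˣ)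
    (hnone : ∀ h₁ ∈ H, ∀ h₂ ∈ H, ((a * h₁ : (ZMod p)ˣ) : ZMod p) + ((b * h₂ : (ZMod p)ˣ) : ZMod p) ≠ 1) :
    ∑ χ ∈ X, ∑ ψ ∈ X, χ ((a⁻¹ : (ZMod p)ˣ) : ZMod p) * ψ ((b⁻¹ : (ZMod p)ˣ) : ZMod p) * jacobiSum χ ψ = 0 := by
  have e1 : ∀ χ ψ : MulChar (ZMod p) ℂ,
      χ ((a⁻¹ : (ZMod p)ˣ) : ZMod p) * ψ ((b⁻¹ : (ZMod p)ˣ) : ZMod p) * jacobiSum χ ψ =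
        ∑ v : ZMod p, χ (((a⁻¹ : (ZMod p)ˣ) : ZMod p) * v) * ψ (((b⁻¹ : (ZMod p)ˣ) : ZMod p) * (1 - v)) := by
    intro χ ψ
    unfold jacobiSum
    rw [Finset.mul_sum]
    refine Finset.sum_congr rfl fun v _ ↦ ?_
    rw [map_mul, map_mul]; ring
  rw [Finset.sum_congr rfl fun χ _ ↦ Finset.sum_congr rfl fun ψ _ ↦ e1 χ ψ,
    Finset.sum_congr rfl fun χ _ ↦ Finset.sum_comm, Finset.sum_comm]
  refine Finset.sum_eq_zero fun v _ ↦ ?_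
  rw [← Finset.sum_mul_sum]
  by_cases hv : v = 0
  · have h0 : ∑ χ ∈ X, χ (((a⁻¹ : (ZMod p)ˣ) : ZMod p) * v) = 0 :=
      Finset.sum_eq_zero fun χ _ ↦ by rw [hv, mul_zero, MulChar.map_zero]
    rw [h0, zero_mul]
  by_cases hv1 : 1 - v = 0
  · have h0 : ∑ ψ ∈ X, ψ (((b⁻¹ : (ZMod p)ˣ) : ZMod p) * (1 - v)) = 0 :=
      Finset.sum_eq_zero fun ψ _ ↦ by rw [hv1, mul_zero, MulChar.map_zero]
    rw [h0, mul_zero]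
  set mv : (ZMod p)ˣ := Units.mk0 v hv with hmv
  set mw : (ZMod p)ˣ := Units.mk0 (1 - v) hv1 with hmw
  have ev : ((a⁻¹ : (ZMod p)ˣ) : ZMod p) * v = ((a⁻¹ * mv : (ZMod p)ˣ) : ZMod p) := by
    rw [Units.val_mul, hmv, Units.val_mk0]
  have ew : ((b⁻¹ : (ZMod p)ˣ) : ZMod p) * (1 - v) = ((b⁻¹ * mw : (ZMod p)ˣ) : ZMod p) := by
    rw [Units.val_mul, hmw, Units.val_mk0]
  rw [ev, ew]
  by_cases h1 : a⁻¹ * mv ∈ H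
  · by_cases h2 : b⁻¹ * mw ∈ H
    · exfalso
      refine hnone _ h1 _ h2 ?_
      rw [mul_inv_cancel_left, mul_inv_cancel_left, hmv, hmw, Units.val_mk0, Units.val_mk0]
      ring
    · rw [sum_apply_eq_zero_of_not_mem X H hmul hinv hsep h2, mul_zero]
  · rw [sum_apply_eq_zero_of_not_mem X H hmul hinv hsep h1, zero_mul]

/-! ## §4. Main term and error bound -/

/-- **The bound.** For `X ∋ 1` closed under inverses: `|Σ_{χ,ψ ∈ X} χ(a⁻¹) ψ(b⁻¹) J(χ,ψ) − (p − 2)| ≤ 3(n−1) + (n−1)(n−2)√p`,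
`n = #X` (the terms with `χ = 1` or `ψ = 1` or `χψ = 1` have norm `1`, the others norm `√p`). [folklore] -/
theorem norm_sum_sum_jacobiSum_sub_le (X : Finset (MulChar (ZMod p) ℂ)) (hone : 1 ∈ X)
    (hinv : ∀ χ ∈ X, χ⁻¹ ∈ X) (a b : (ZMod p)ˣ) :
    ‖∑ χ ∈ X, ∑ ψ ∈ X, χ ((a⁻¹ : (ZMod p)ˣ) : ZMod p) * ψ ((b⁻¹ : (ZMod p)ˣ) : ZMod p) * jacobiSum χ ψ - ((p : ℂ) - 2)‖
      ≤ 3 * ((X.card - 1 : ℕ) : ℝ) + ((X.card - 1 : ℕ) : ℝ) * ((X.card - 2 : ℕ) : ℝ) * Real.sqrt p := by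
  classical
  set c : MulChar (ZMod p) ℂ → MulChar (ZMod p) ℂ → ℂ :=
    fun χ ψ ↦ χ ((a⁻¹ : (ZMod p)ˣ) : ZMod p) * ψ ((b⁻¹ : (ZMod p)ˣ) : ZMod p) * jacobiSum χ ψ with hc
  set X' : Finset (MulChar (ZMod p) ℂ) := X.erase 1 with hX'
  have hcard' : X'.card = X.card - 1 := Finset.card_erase_of_mem hone
  have na : ∀ χ : MulChar (ZMod p) ℂ, ‖χ ((a⁻¹ : (ZMod p)ˣ) : ZMod p)‖ = 1 := fun χ ↦ norm_apply_coe_units χ a⁻¹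
  have nb : ∀ ψ : MulChar (ZMod p) ℂ, ‖ψ ((b⁻¹ : (ZMod p)ˣ) : ZMod p)‖ = 1 := fun ψ ↦ norm_apply_coe_units ψ b⁻¹
  -- the main term
  have c11 : c 1 1 = (p : ℂ) - 2 := by
    simp only [hc]
    rw [MulChar.one_apply_coe, MulChar.one_apply_coe, jacobiSum_one_one, ZMod.card]
    ring
  -- the degenerate terms have norm `1`
  have n1ψ : ∀ ψ ∈ X', ‖c 1 ψ‖ = 1 := by
    intro ψ hψ
    have hψ1 : ψ ≠ 1 := Finset.ne_of_mem_erase hψ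
    simp only [hc]
    rw [norm_mul, norm_mul, MulChar.one_apply_coe, norm_one, nb, jacobiSum_one_nontrivial hψ1, norm_neg, norm_one]
    ring
  have nχ1 : ∀ χ ∈ X', ‖c χ 1‖ = 1 := by
    intro χ hχ
    have hχ1 : χ ≠ 1 := Finset.ne_of_mem_erase hχ
    simp only [hc]
    rw [norm_mul, norm_mul, na, MulChar.one_apply_coe, norm_one, jacobiSum_comm, jacobiSum_one_nontrivial hχ1,
      norm_neg, norm_one]
    ring
  have nχinv : ∀ χ ∈ X', ‖c χ χ⁻¹‖ = 1 := by
    intro χ hχ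
    have hχ1 : χ ≠ 1 := Finset.ne_of_mem_erase hχ
    have hm1 : ‖χ (-1 : ZMod p)‖ = 1 := by
      have h := norm_apply_coe_units χ (-1)
      rwa [Units.val_neg, Units.val_one] at h
    simp only [hc]
    rw [norm_mul, norm_mul, na, nb, jacobiSum_nontrivial_inv hχ1, norm_neg, hm1]
    ring
  -- the generic terms have norm `√p`
  have nχψ : ∀ χ ∈ X', ∀ ψ ∈ X'.erase χ⁻¹, ‖c χ ψ‖ = Real.sqrt p := by
    intro χ hχ ψ hψ
    have hχ1 : χ ≠ 1 := Finset.ne_of_mem_erase hχ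
    have hψinv : ψ ≠ χ⁻¹ := Finset.ne_of_mem_erase hψ
    have hψ1 : ψ ≠ 1 := Finset.ne_of_mem_erase (Finset.mem_of_mem_erase hψ)
    have hχψ : χ * ψ ≠ 1 := fun h ↦ hψinv (eq_inv_of_mul_eq_one_right h)
    simp only [hc]
    rw [norm_mul, norm_mul, na, nb, norm_jacobiSum_eq_sqrt hχ1 hψ1 hχψ]
    ring
  -- decomposition of the double sum
  have hsplit1 : ∑ χ ∈ X, ∑ ψ ∈ X, c χ ψ = ∑ ψ ∈ X, c 1 ψ + ∑ χ ∈ X', ∑ ψ ∈ X, c χ ψ :=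
    (Finset.add_sum_erase X (fun χ ↦ ∑ ψ ∈ X, c χ ψ) hone).symm
  have hsplit2 : ∑ ψ ∈ X, c 1 ψ = c 1 1 + ∑ ψ ∈ X', c 1 ψ := (Finset.add_sum_erase X (fun ψ ↦ c 1 ψ) hone).symm
  have hinvX' : ∀ χ ∈ X', χ⁻¹ ∈ X' := fun χ hχ ↦
    Finset.mem_erase.mpr ⟨inv_ne_one.mpr (Finset.ne_of_mem_erase hχ), hinv χ (Finset.mem_of_mem_erase hχ)⟩
  have hsplit3 : ∀ χ ∈ X', ∑ ψ ∈ X, c χ ψ = c χ 1 + (c χ χ⁻¹ + ∑ ψ ∈ X'.erase χ⁻¹, c χ ψ) := by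
    intro χ hχ
    rw [← Finset.add_sum_erase X (fun ψ ↦ c χ ψ) hone, ← Finset.add_sum_erase X' (fun ψ ↦ c χ ψ) (hinvX' χ hχ)]
  -- the two error pieces
  have hA : ‖∑ ψ ∈ X', c 1 ψ‖ ≤ ((X.card - 1 : ℕ) : ℝ) := by
    refine (norm_sum_le _ _).trans ?_
    rw [Finset.sum_congr rfl n1ψ, Finset.sum_const, nsmul_eq_mul, mul_one, hcard']
  have hBχ : ∀ χ ∈ X', ‖∑ ψ ∈ X, c χ ψ‖ ≤ 2 + ((X.card - 2 : ℕ) : ℝ) * Real.sqrt p := by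
    intro χ hχ
    have hcard'' : (X'.erase χ⁻¹).card = X.card - 2 := by
      rw [Finset.card_erase_of_mem (hinvX' χ hχ), hcard']; omega
    rw [hsplit3 χ hχ]
    have i1 := norm_add_le (c χ 1) (c χ χ⁻¹ + ∑ ψ ∈ X'.erase χ⁻¹, c χ ψ)
    have i2 := norm_add_le (c χ χ⁻¹) (∑ ψ ∈ X'.erase χ⁻¹, c χ ψ)
    have i3 := norm_sum_le (X'.erase χ⁻¹) (fun ψ ↦ c χ ψ)
    rw [Finset.sum_congr rfl (nχψ χ hχ), Finset.sum_const, nsmul_eq_mul, hcard''] at i3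
    rw [nχ1 χ hχ] at i1
    rw [nχinv χ hχ] at i2
    linarith
  have hB : ‖∑ χ ∈ X', ∑ ψ ∈ X, c χ ψ‖ ≤ ((X.card - 1 : ℕ) : ℝ) * (2 + ((X.card - 2 : ℕ) : ℝ) * Real.sqrt p) := by
    refine (norm_sum_le _ _).trans ?_
    refine (Finset.sum_le_sum hBχ).trans ?_
    rw [Finset.sum_const, nsmul_eq_mul, hcard']
  -- assembly
  have e : ∑ χ ∈ X, ∑ ψ ∈ X, c χ ψ - ((p : ℂ) - 2) = ∑ ψ ∈ X', c 1 ψ + ∑ χ ∈ X', ∑ ψ ∈ X, c χ ψ := by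
    rw [hsplit1, hsplit2, c11]; ring
  show ‖∑ χ ∈ X, ∑ ψ ∈ X, c χ ψ - ((p : ℂ) - 2)‖ ≤ _
  rw [e]
  refine (norm_add_le _ _).trans ?_
  refine (add_le_add hA hB).trans ?_
  nlinarith [Real.sqrt_nonneg (p : ℝ), Nat.cast_nonneg (α := ℝ) (X.card - 1), Nat.cast_nonneg (α := ℝ) (X.card - 2)]

/-! ## §5. Conclusion: every pair of cosets is realised when `p` is large against the index -/

/-- **Every pair of cosets is realised.** For `X` as above (the annihilator of `H`, `#X = n`) and
`3(n−1) + 2 < p`, `((n−1)(n−2))² p < (p − 2 − 3(n−1))²`: for all units `a, b` there are `h₁, h₂ ∈ H` with `a h₁ + b h₂ = 1`,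
i.e. some `v ∈ aH` has `1 − v ∈ bH`. [folklore] -/
theorem exists_mem_coset_pair (X : Finset (MulChar (ZMod p) ℂ)) (H : Subgroup (ZMod p)ˣ) (hone : 1 ∈ X)
    (hmul : ∀ χ ∈ X, ∀ ψ ∈ X, χ * ψ ∈ X) (hinv : ∀ χ ∈ X, χ⁻¹ ∈ X)
    (hsep : ∀ m : (ZMod p)ˣ, m ∉ H → ∃ χ ∈ X, χ (m : ZMod p) ≠ 1)
    (hineq : 3 * (X.card - 1) + 2 < p ∧ ((X.card - 1) * (X.card - 2)) ^ 2 * p < (p - 2 - 3 * (X.card - 1)) ^ 2)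
    (a b : (ZMod p)ˣ) :
    ∃ h₁ ∈ H, ∃ h₂ ∈ H, ((a * h₁ : (ZMod p)ˣ) : ZMod p) + ((b * h₂ : (ZMod p)ˣ) : ZMod p) = 1 := by
  by_contra hcon
  push Not at hcon
  have h0 := sum_sum_jacobiSum_eq_zero_of_forall_ne X H hmul hinv hsep a b hcon
  have hle := norm_sum_sum_jacobiSum_sub_le X hone hinv a b
  rw [h0, zero_sub, norm_neg] at hle
  obtain ⟨h1, h2⟩ := hineq
  have hnorm : ‖(p : ℂ) - 2‖ = (p : ℝ) - 2 := by
    have hp2' : (2 : ℝ) ≤ p := by exact_mod_cast (Fact.out : p.Prime).two_le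
    rw [show (p : ℂ) - 2 = ((p - 2 : ℝ) : ℂ) by push_cast; ring, Complex.norm_real, Real.norm_eq_abs,
      abs_of_nonneg (by linarith)]
  rw [hnorm] at hle
  -- cast the numeric hypothesis to `ℝ`
  have hA : ((p - 2 - 3 * (X.card - 1) : ℕ) : ℝ) = (p : ℝ) - 2 - 3 * ((X.card - 1 : ℕ) : ℝ) := by
    rw [Nat.sub_sub, Nat.cast_sub (by omega)]
    push_cast
    ring
  have h2' : (((X.card - 1 : ℕ) : ℝ) * ((X.card - 2 : ℕ) : ℝ)) ^ 2 * (p : ℝ) <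
      ((p : ℝ) - 2 - 3 * ((X.card - 1 : ℕ) : ℝ)) ^ 2 := by
    rw [← hA]; exact_mod_cast h2
  have hApos : 0 ≤ (p : ℝ) - 2 - 3 * ((X.card - 1 : ℕ) : ℝ) := by
    rw [← hA]; exact Nat.cast_nonneg _
  have hB : ((X.card - 1 : ℕ) : ℝ) * ((X.card - 2 : ℕ) : ℝ) * Real.sqrt p < (p : ℝ) - 2 - 3 * ((X.card - 1 : ℕ) : ℝ) := by
    refine lt_of_pow_lt_pow_left₀ 2 hApos ?_
    rw [mul_pow, Real.sq_sqrt (Nat.cast_nonneg _)]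
    exact h2'
  linarith

end Summit.BirchSwinnertonDyer.BirchSwinnertonDyer.Theorems.SignedMuAtTwo.CharacterSums
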